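import Mathlib.RingTheory.RootsOfUnity.PrimitiveRoots
import Mathlib.Algebra.BigOperators.Pi
import Mathlib.Algebra.Group.TypeTags.Basic
import Mathlib.Data.ZMod.Basic
import HarnessLib

/-!
# Transport of level-`M` similitude data along a pair of bases with corresponding Gram values

Layer `Literature/GroupTheory/FiniteAbelian`, namespace `Literature.GroupTheory.FiniteAbelian`.
THEOREMS ONLY (no definition, no named fact, no instance, no `sorry`).

The pure algebra of [Lan2013PELCompactifications] Lemma 1.3.6.6 («symplectic-liftable at one geometric point ⇒ at every geometric
point of the connected base»), finite level `M` (cell hodgecm-mathlib (h9-S): ★ `SymplecticLiftOfFiniteLevels` makes liftability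
level-by-level).  Two «fibres» are abstract commutative groups `V₀`, `V₁` (the `M`-torsion of `A_{s̄₀}`, `A_{s̄₁}`) with pairings
`pᵢ : Vᵢ → Vᵢ → Ωᵢ` into domains (the level-`M` Weil pairings), bimultiplicative with values in `μ_M`; BASES
`Ψᵢ : (ℤ/M)^I ⥲ Vᵢ` (a universal level-`M` structure of a connected finite étale cover read at two geometric points) whose
GRAM VALUES CORRESPOND under a map `χ : Ω₀ → Ω₁` compatible with powers on `μ_M(Ω₀)` and carrying primitive roots to primitive
roots (★ `RootsOfUnityEvaluationTransport.exists_rootsOfUnity_transport`): `χ (p₀ (Ψ₀ e_a) (Ψ₀ e_b)) = p₁ (Ψ₁ e_a) (Ψ₁ e_b)`.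
THEN every level-`M` similitude datum at `0` — `ζ₀` primitive, `L₀ : (ℤ/M)^I ⥲ V₀` with `p₀ (L₀ x) (L₀ y) = ζ₀^{E(x,y)}` and
markings `(L₀ e_i)^k = m₀ i` — TRANSPORTS to one at `1` along `ι := Ψ₁ ∘ Ψ₀⁻¹` and `χ`, with markings `m₁ i` whenever the markings
have the same coordinates in the two bases.

* §1 `apply_one_left_eq_one` / `apply_one_right_eq_one` (a bimultiplicative `μ_M`-valued pairing is `1` on the unit),
  `map_mul_of_pow_eq_one` (`χ` compatible with powers + a primitive root ⇒ `χ` multiplicative on `μ_M`),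
  `monoidHom_ext_single` (homomorphisms out of `(ℤ/M)^I` are determined on the `e_a`);
* §2 `pairing_basis_eq` — the Gram correspondence extends from basis pairs to ALL pairs: `p₁ (Ψ₁ v) (Ψ₁ w) = χ (p₀ (Ψ₀ v) (Ψ₀ w))`;
* §3 **`exists_similitude_transport`** — THE HEAD.

Cell hodgecm-mathlib (D-0151), F-DAG (h9) symplectic half, (W3-alg) brick 2 (census `B-provers/B-p13/g18/CENSUS-h9S-W2-FibreIdentification` §3).
Count-neutral; HC_CM is proved only modulo the 7 printed citations until rung 0 closes — nothing here is about HC.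

## References
* [Lan2013PELCompactifications] K.-W. Lan, *Arithmetic compactifications of PEL-type Shimura varieties* (2013), §1.3.6 Lemma 1.3.6.6
  and Cor. 1.3.6.7 (pp. 81–82); §1.3.7 Lemma 1.3.7.2 (p. 83).
-/

set_option autoImplicit false

namespace Literature.GroupTheory.FiniteAbelian

/-! ## §1 Bimultiplicative `μ_M`-valued pairings; maps compatible with powers; homomorphisms out of `(ℤ/M)^I` -/

section Pairing

variable {V Ω : Type*} [CommGroup V] [CommRing Ω] [IsDomain Ω] {M : ℕ} (p : V → V → Ω)

/-- A bimultiplicative pairing with `M`-torsion values (`M ≠ 0`) is `1` on the unit, left slot.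
[cite: Lan2013PELCompactifications, §1.3.6 Lemma 1.3.6.6 (pp. 81–82)] -/
theorem apply_one_left_eq_one (hM : M ≠ 0) (hl : ∀ x y z, p (x * y) z = p x z * p y z) (hv : ∀ x y, p x y ^ M = 1) (z : V) :
    p 1 z = 1 := by
  have h := hl 1 1 z
  rw [one_mul] at h
  have hne : p 1 z ≠ 0 := fun h0 => by
    have := hv 1 z
    rw [h0, zero_pow hM] at this
    exact zero_ne_one this
  -- `p = p * p` with `p ≠ 0`
  have : p 1 z * (p 1 z - 1) = 0 := by rw [mul_sub, mul_one, ← h, sub_self]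
  rcases mul_eq_zero.1 this with h0 | h1
  · exact (hne h0).elim
  · exact sub_eq_zero.1 h1

/-- A bimultiplicative pairing with `M`-torsion values (`M ≠ 0`) is `1` on the unit, right slot.
[cite: Lan2013PELCompactifications, §1.3.6 Lemma 1.3.6.6 (pp. 81–82)] -/
theorem apply_one_right_eq_one (hM : M ≠ 0) (hr : ∀ x y z, p x (y * z) = p x y * p x z) (hv : ∀ x y, p x y ^ M = 1) (x : V) :
    p x 1 = 1 :=
  apply_one_left_eq_one (fun a b => p b a) hM (fun a b c => hr c a b) (fun a b => hv b a) x

end Pairing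

/-- **A map compatible with powers on `μ_M` is multiplicative on `μ_M`** when `Ω₀` has a primitive `M`-th root `ζ`: every
`M`-th root of unity is `ζ^i`, and `χ(ζ^{i+j}) = χ(ζ)^{i+j}`. [cite: Lan2013PELCompactifications, §1.3.6 Lemma 1.3.6.6 (pp. 81–82)] -/
theorem map_mul_of_pow_eq_one {Ω₀ Ω₁ : Type*} [CommRing Ω₀] [IsDomain Ω₀] [CommMonoid Ω₁] {M : ℕ} [NeZero M] {ζ : Ω₀}
    (hζ : IsPrimitiveRoot ζ M) (χ : Ω₀ → Ω₁) (hχ : ∀ z : Ω₀, z ^ M = 1 → ∀ e : ℕ, χ (z ^ e) = χ z ^ e)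
    {z z' : Ω₀} (hz : z ^ M = 1) (hz' : z' ^ M = 1) : χ (z * z') = χ z * χ z' := by
  obtain ⟨i, -, rfl⟩ := hζ.eq_pow_of_pow_eq_one hz
  obtain ⟨j, -, rfl⟩ := hζ.eq_pow_of_pow_eq_one hz'
  rw [← pow_add, hχ ζ hζ.pow_eq_one, hχ ζ hζ.pow_eq_one, hχ ζ hζ.pow_eq_one, pow_add]

/-- `χ 1 = 1` for a map compatible with powers on `μ_M`. [cite: Lan2013PELCompactifications, §1.3.6 Lemma 1.3.6.6 (pp. 81–82)] -/
theorem map_one_of_pow {Ω₀ Ω₁ : Type*} [Monoid Ω₀] [Monoid Ω₁] {M : ℕ} (χ : Ω₀ → Ω₁)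
    (hχ : ∀ z : Ω₀, z ^ M = 1 → ∀ e : ℕ, χ (z ^ e) = χ z ^ e) : χ 1 = 1 := by
  have h := hχ 1 (one_pow M) 0
  rwa [pow_zero, pow_zero] at h

/-- **Homomorphisms out of `(ℤ/M)^I` are determined by their values on the basis vectors `e_a`** (`Pi.single a 1`).
[cite: Lan2013PELCompactifications, §1.3.7 Lemma 1.3.7.2 (p. 83)] -/
theorem monoidHom_ext_single {I : Type*} [Fintype I] [DecidableEq I] {M : ℕ} [NeZero M] {N : Type*} [CommMonoid N]
    {f f' : Multiplicative (I → ZMod M) →* N}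
    (h : ∀ a : I, f (Multiplicative.ofAdd (Pi.single a 1)) = f' (Multiplicative.ofAdd (Pi.single a 1))) : f = f' := by
  refine MonoidHom.ext fun x => ?_
  have hx : x = ∏ a, Multiplicative.ofAdd (Pi.single a ((Multiplicative.toAdd x) a)) := by
    rw [← ofAdd_sum, Finset.univ_sum_single, ofAdd_toAdd]
  rw [hx, map_prod, map_prod]
  refine Finset.prod_congr rfl fun a _ => ?_
  have h1 : (Pi.single a ((Multiplicative.toAdd x) a) : I → ZMod M) = ((Multiplicative.toAdd x) a).val • Pi.single a 1 := by
    rw [← Pi.single_smul, nsmul_eq_mul, mul_one, ZMod.natCast_zmod_val]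
  rw [h1, ofAdd_nsmul, map_pow, map_pow, h]

/-! ## §2 The Gram correspondence extends from basis pairs to all pairs -/

section Gram

variable {I : Type*} [Fintype I] [DecidableEq I] {M : ℕ} [NeZero M]
  {V₀ V₁ Ω₀ Ω₁ : Type*} [CommGroup V₀] [CommGroup V₁] [CommRing Ω₀] [IsDomain Ω₀] [CommRing Ω₁] [IsDomain Ω₁]
  (p₀ : V₀ → V₀ → Ω₀) (p₁ : V₁ → V₁ → Ω₁)
  (hl₀ : ∀ x y z, p₀ (x * y) z = p₀ x z * p₀ y z) (hr₀ : ∀ x y z, p₀ x (y * z) = p₀ x y * p₀ x z)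
  (hv₀ : ∀ x y, p₀ x y ^ M = 1)
  (hl₁ : ∀ x y z, p₁ (x * y) z = p₁ x z * p₁ y z) (hr₁ : ∀ x y z, p₁ x (y * z) = p₁ x y * p₁ x z)
  (hv₁ : ∀ x y, p₁ x y ^ M = 1)
  (Ψ₀ : Multiplicative (I → ZMod M) →* V₀) (Ψ₁ : Multiplicative (I → ZMod M) →* V₁)
  {ζ : Ω₀} (hζ : IsPrimitiveRoot ζ M) (χ : Ω₀ → Ω₁) (hχ : ∀ z : Ω₀, z ^ M = 1 → ∀ e : ℕ, χ (z ^ e) = χ z ^ e)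
  (hGram : ∀ a b : I, χ (p₀ (Ψ₀ (Multiplicative.ofAdd (Pi.single a 1))) (Ψ₀ (Multiplicative.ofAdd (Pi.single b 1)))) =
    p₁ (Ψ₁ (Multiplicative.ofAdd (Pi.single a 1))) (Ψ₁ (Multiplicative.ofAdd (Pi.single b 1))))

include hl₀ hr₀ hv₀ hl₁ hr₁ hv₁ hζ hχ hGram in
/-- **The Gram correspondence on basis pairs extends to all pairs**: `p₁ (Ψ₁ v) (Ψ₁ w) = χ (p₀ (Ψ₀ v) (Ψ₀ w))` for all `v, w` —
both sides are bimultiplicative in `(v, w)` (`χ` is multiplicative on `μ_M`, §1) and agree on the `(e_a, e_b)`.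
[cite: Lan2013PELCompactifications, §1.3.6 Lemma 1.3.6.6 (pp. 81–82)] -/
theorem pairing_basis_eq (v w : Multiplicative (I → ZMod M)) : p₁ (Ψ₁ v) (Ψ₁ w) = χ (p₀ (Ψ₀ v) (Ψ₀ w)) := by
  have hM : M ≠ 0 := NeZero.ne M
  have hχ1 : χ 1 = 1 := map_one_of_pow χ hχ
  -- Step 1: for the basis vectors `e_a` on the left, agreement for all `w` (homomorphisms in `w`)
  have step1 : ∀ a : I, ∀ w, p₁ (Ψ₁ (Multiplicative.ofAdd (Pi.single a 1))) (Ψ₁ w) =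
      χ (p₀ (Ψ₀ (Multiplicative.ofAdd (Pi.single a 1))) (Ψ₀ w)) := by
    intro a
    let F : Multiplicative (I → ZMod M) →* Ω₁ :=
      { toFun := fun w => p₁ (Ψ₁ (Multiplicative.ofAdd (Pi.single a 1))) (Ψ₁ w)
        map_one' := by rw [map_one]; exact apply_one_right_eq_one p₁ hM hr₁ hv₁ _
        map_mul' := fun x y => by simp only [map_mul]; exact hr₁ _ _ _ }
    let G : Multiplicative (I → ZMod M) →* Ω₁ :=
      { toFun := fun w => χ (p₀ (Ψ₀ (Multiplicative.ofAdd (Pi.single a 1))) (Ψ₀ w))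
        map_one' := by rw [map_one, apply_one_right_eq_one p₀ hM hr₀ hv₀, hχ1]
        map_mul' := fun x y => by
          simp only [map_mul]
          rw [hr₀, map_mul_of_pow_eq_one hζ χ hχ (hv₀ _ _) (hv₀ _ _)] }
    have hFG : F = G := monoidHom_ext_single fun b => (hGram a b).symm
    intro w
    exact DFunLike.congr_fun hFG w
  -- Step 2: homomorphisms in `v`
  let F : Multiplicative (I → ZMod M) →* Ω₁ :=
    { toFun := fun v => p₁ (Ψ₁ v) (Ψ₁ w)
      map_one' := by rw [map_one]; exact apply_one_left_eq_one p₁ hM hl₁ hv₁ _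
      map_mul' := fun x y => by simp only [map_mul]; exact hl₁ _ _ _ }
  let G : Multiplicative (I → ZMod M) →* Ω₁ :=
    { toFun := fun v => χ (p₀ (Ψ₀ v) (Ψ₀ w))
      map_one' := by rw [map_one, apply_one_left_eq_one p₀ hM hl₀ hv₀, hχ1]
      map_mul' := fun x y => by
        simp only [map_mul]
        rw [hl₀, map_mul_of_pow_eq_one hζ χ hχ (hv₀ _ _) (hv₀ _ _)] }
  have hFG : F = G := monoidHom_ext_single fun a => step1 a w
  exact DFunLike.congr_fun hFG v

end Gram

/-! ## §3 The transport of a level-`M` similitude datum -/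

/-- **TRANSPORT OF LEVEL-`M` SIMILITUDE DATA.**  In the setting of §2 (two fibres `V₀, V₁` with bimultiplicative `μ_M`-valued
pairings `p₀, p₁`, bases `Ψ₀, Ψ₁ : (ℤ/M)^I ⥲ Vᵢ` with Gram values corresponding under `χ`, `χ` compatible with powers and
carrying primitive roots to primitive roots), let `(ζ₀, L₀)` be a level-`M` similitude at `0` — `ζ₀` a primitive `M`-th root,
`L₀ : (ℤ/M)^I ⥲ V₀` with `p₀ (L₀ x) (L₀ y) = ζ₀^{E(x,y)}` — with markings `(L₀ eᵢ)^k = m₀ i`, and let the markings `m₀, m₁`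
have the same coordinates (`Ψ₀ cᵢ = m₀ i`, `Ψ₁ cᵢ = m₁ i`; e.g. the `2g` sections of a level-`N` structure read through a
universal level-`M` basis of a connected cover, ★ `TorsionPointsLocallyConstant`).  Then `(χ ζ₀, Ψ₁ ∘ Ψ₀⁻¹ ∘ L₀)` is a
level-`M` similitude at `1` with markings `m₁`.  With ★ `SymplecticLiftOfFiniteLevels` (König) this is the transport of
symplectic-liftability of [Lan2013PELCompactifications] Lemma 1.3.6.6, given the geometry that produces `Ψᵢ`, `χ` and the
Gram correspondence. [cite: Lan2013PELCompactifications, §1.3.6 Lemma 1.3.6.6 and Cor. 1.3.6.7 (pp. 81–82)] -/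
theorem exists_similitude_transport {I : Type*} [Fintype I] [DecidableEq I] {M : ℕ} [NeZero M]
    {V₀ V₁ Ω₀ Ω₁ : Type*} [CommGroup V₀] [CommGroup V₁] [CommRing Ω₀] [IsDomain Ω₀] [CommRing Ω₁] [IsDomain Ω₁]
    (p₀ : V₀ → V₀ → Ω₀) (p₁ : V₁ → V₁ → Ω₁)
    (hl₀ : ∀ x y z, p₀ (x * y) z = p₀ x z * p₀ y z) (hr₀ : ∀ x y z, p₀ x (y * z) = p₀ x y * p₀ x z)
    (hv₀ : ∀ x y, p₀ x y ^ M = 1)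
    (hl₁ : ∀ x y z, p₁ (x * y) z = p₁ x z * p₁ y z) (hr₁ : ∀ x y z, p₁ x (y * z) = p₁ x y * p₁ x z)
    (hv₁ : ∀ x y, p₁ x y ^ M = 1)
    (Ψ₀ : Multiplicative (I → ZMod M) →* V₀) (hΨ₀ : Function.Bijective Ψ₀)
    (Ψ₁ : Multiplicative (I → ZMod M) →* V₁) (hΨ₁ : Function.Bijective Ψ₁)
    (χ : Ω₀ → Ω₁) (hχprim : ∀ z : Ω₀, IsPrimitiveRoot z M → IsPrimitiveRoot (χ z) M)
    (hχ : ∀ z : Ω₀, z ^ M = 1 → ∀ e : ℕ, χ (z ^ e) = χ z ^ e)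
    (hGram : ∀ a b : I, χ (p₀ (Ψ₀ (Multiplicative.ofAdd (Pi.single a 1))) (Ψ₀ (Multiplicative.ofAdd (Pi.single b 1)))) =
      p₁ (Ψ₁ (Multiplicative.ofAdd (Pi.single a 1))) (Ψ₁ (Multiplicative.ofAdd (Pi.single b 1))))
    (E : (I → ZMod M) → (I → ZMod M) → ZMod M) (k : ℕ) (m₀ : I → V₀) (m₁ : I → V₁)
    (hm : ∀ i : I, ∃ c : Multiplicative (I → ZMod M), Ψ₀ c = m₀ i ∧ Ψ₁ c = m₁ i)
    {ζ₀ : Ω₀} (hζ₀ : IsPrimitiveRoot ζ₀ M) (L₀ : Multiplicative (I → ZMod M) →* V₀) (hL₀ : Function.Bijective L₀)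
    (hmark₀ : ∀ i : I, L₀ (Multiplicative.ofAdd (Pi.single i 1)) ^ k = m₀ i)
    (hpair₀ : ∀ x y : I → ZMod M, p₀ (L₀ (Multiplicative.ofAdd x)) (L₀ (Multiplicative.ofAdd y)) = ζ₀ ^ (E x y).val) :
    ∃ (ζ₁ : Ω₁) (L₁ : Multiplicative (I → ZMod M) →* V₁), IsPrimitiveRoot ζ₁ M ∧ Function.Bijective L₁ ∧
      (∀ i : I, L₁ (Multiplicative.ofAdd (Pi.single i 1)) ^ k = m₁ i) ∧
      ∀ x y : I → ZMod M, p₁ (L₁ (Multiplicative.ofAdd x)) (L₁ (Multiplicative.ofAdd y)) = χ ζ₀ ^ (E x y).val := by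
  -- `ι := Ψ₁ ∘ Ψ₀⁻¹`
  let e₀ : Multiplicative (I → ZMod M) ≃* V₀ := MulEquiv.ofBijective Ψ₀ hΨ₀
  let T : V₀ →* V₁ := Ψ₁.comp e₀.symm.toMonoidHom
  have hT : ∀ c, T (Ψ₀ c) = Ψ₁ c := fun c => by
    change Ψ₁ (e₀.symm (e₀ c)) = Ψ₁ c
    rw [e₀.symm_apply_apply]
  have hTbij : Function.Bijective T := hΨ₁.comp e₀.symm.bijective
  refine ⟨χ ζ₀, T.comp L₀, hχprim ζ₀ hζ₀, hTbij.comp hL₀, fun i => ?_, fun x y => ?_⟩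
  · -- markings
    obtain ⟨c, hc₀, hc₁⟩ := hm i
    rw [MonoidHom.comp_apply, ← map_pow, hmark₀ i, ← hc₀, hT, hc₁]
  · -- the similitude clause: `p₁ (T a) (T b) = χ (p₀ a b)` through §2
    have key : ∀ a b : V₀, p₁ (T a) (T b) = χ (p₀ a b) := fun a b => by
      obtain ⟨v, rfl⟩ := hΨ₀.2 a
      obtain ⟨w, rfl⟩ := hΨ₀.2 b
      rw [hT, hT]
      exact pairing_basis_eq p₀ p₁ hl₀ hr₀ hv₀ hl₁ hr₁ hv₁ Ψ₀ Ψ₁ hζ₀ χ hχ hGram v w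
    have hcomp : ∀ z, (T.comp L₀) z = T (L₀ z) := fun _ => rfl
    rw [hcomp, hcomp, key, hpair₀, hχ ζ₀ hζ₀.pow_eq_one]

end Literature.GroupTheory.FiniteAbelian
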